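import Literature.AlgebraicGeometry.FundamentalGroup.HypersurfaceComplementMeridians
import Mathlib.RingTheory.Polynomial.UniqueFactorization
import Mathlib.RingTheory.UniqueFactorizationDomain.NormalizedFactors
import HarnessLib

/-!
# K1-B meridian package, G2 part (e): the DISTINCT prime factors of a polynomial, with multiplicities
# (route `SignSymmetricPowers`, item stmt-HodgeConjecture-19716; helper for GEN / LINK-G)

Helper file (`--supports stmt-HodgeConjecture-19716`).  The Zariski–van Kampen fact
`affineHypersurfaceComplement_meridians_normalClosure_eq_top` wants a meridian for EVERY listed component `h j`, and
`Meridian h s j` is unsatisfiable at a repeated index (its field `eval_center_ne` fails for the twin copy); so the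
assembler of GEN must list the prime factors of the restricted discriminant `D_M` WITHOUT repetition — `D_M` has a
repeated factor (the pair component enters squared, `SignSymmetricPowersGenPairCentre`).  This file provides that
factorisation (complementing `SignSymmetricPowersMeridianChart.exists_irreducible_factors`, which lists the factor
multiset with repetitions):

* `exists_distinct_irreducible_factors` — `D ≠ 0` in `ℂ[x_σ]` is `w · ∏ⱼ hⱼ^{eⱼ}` with `w` a unit, `hⱼ` irreducible and
  pairwise NON-associated, `eⱼ ≥ 1`, and `{D ≠ 0} = affineHypersurfaceComplement h`.

Sorry-free; axioms standard; no definition, no named fact.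

## References

* [Shimada2010ZvK] I. Shimada, Lectures on Zariski–van Kampen theorem, §3 Prop. 3.4 (one meridian per component).
-/

noncomputable section

set_option linter.dupNamespace false

open MvPolynomial UniqueFactorizationMonoid
open Literature.AlgebraicGeometry.FundamentalGroup

namespace Summit.HodgeConjecture.HodgeConjecture.Theorems.SignSymmetricPowersGenFactors

variable {σ : Type}

/-- **Distinct prime factors with multiplicities.**  Every non-zero `D ∈ ℂ[x_σ]` is `w · ∏ⱼ hⱼ^{eⱼ}` with `w` a unit,
`h : Fin m → ℂ[x_σ]` irreducible and pairwise non-associated, all `eⱼ ≥ 1`; and `D(a) ≠ 0` iff `hⱼ(a) ≠ 0` for all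
`j` (`{D ≠ 0}` is the complement of the arrangement `⋃ V(hⱼ)`). [cite: Shimada2010ZvK, §3 (setting of Prop. 3.4)] -/
theorem exists_distinct_irreducible_factors (D : MvPolynomial σ ℂ) (hD : D ≠ 0) :
    ∃ (m : ℕ) (h : Fin m → MvPolynomial σ ℂ) (e : Fin m → ℕ) (w : MvPolynomial σ ℂ),
      IsUnit w ∧ (∀ j, Irreducible (h j)) ∧ (∀ i j, i ≠ j → ¬ Associated (h i) (h j)) ∧ (∀ j, 1 ≤ e j) ∧
      D = w * ∏ j, h j ^ e j ∧
      ∀ a : σ → ℂ, MvPolynomial.eval a D ≠ 0 ↔ a ∈ affineHypersurfaceComplement h := by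
  classical
  letI : StrongNormalizationMonoid (MvPolynomial σ ℂ) := UniqueFactorizationMonoid.strongNormalizationMonoid
  set F := normalizedFactors D with hF
  obtain ⟨u, hu⟩ := prod_normalizedFactors hD
  set l := F.toFinset.toList with hl
  have hnodup : l.Nodup := Finset.nodup_toList _
  have hmem : ∀ j : Fin l.length, l.get j ∈ F := fun j =>
    Multiset.mem_toFinset.mp (Finset.mem_toList.mp (List.get_mem l j))
  -- `D = u · ∏_j (l j) ^ count`
  have hprod : ∏ j : Fin l.length, l.get j ^ F.count (l.get j) = ∏ p ∈ F.toFinset, p ^ F.count p := by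
    rw [← Finset.prod_map_toList F.toFinset (fun p => p ^ F.count p), ← hl, ← List.prod_ofFn]
    congr 1
    simp only [List.get_eq_getElem]
    exact List.ofFn_getElem_eq_map l (fun p => p ^ F.count p)
  have hD' : D = (u : MvPolynomial σ ℂ) * ∏ j : Fin l.length, l.get j ^ F.count (l.get j) := by
    rw [hprod, ← Finset.prod_multiset_count, mul_comm]
    exact hu.symm
  refine ⟨l.length, fun j => l.get j, fun j => F.count (l.get j), (u : MvPolynomial σ ℂ), u.isUnit,
    fun j => irreducible_of_normalized_factor _ (hmem j), fun i j hij hassoc => ?_, fun j => ?_, hD', fun a => ?_⟩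
  · -- non-associated: associated normalized factors are equal, and `l` has no duplicates
    have heq : l.get i = l.get j :=
      hassoc.eq_of_normalized (normalize_normalized_factor _ (hmem i)) (normalize_normalized_factor _ (hmem j))
    exact hij (hnodup.get_inj_iff.mp heq)
  · exact Multiset.one_le_count_iff_mem.mpr (hmem j)
  · rw [mem_affineHypersurfaceComplement_iff, hD', map_mul, map_prod]
    simp only [map_pow]
    constructor
    · intro hne j hj
      apply hne
      apply mul_eq_zero_of_right
      have hcnt : F.count (l.get j) ≠ 0 := by
        have := Multiset.one_le_count_iff_mem.mpr (hmem j); omega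
      exact Finset.prod_eq_zero (Finset.mem_univ j) (by rw [hj, zero_pow hcnt])
    · intro hall
      refine mul_ne_zero ((u.isUnit.map (MvPolynomial.eval a)).ne_zero) ?_
      exact Finset.prod_ne_zero_iff.mpr fun j _ => pow_ne_zero _ (hall j)

end Summit.HodgeConjecture.HodgeConjecture.Theorems.SignSymmetricPowersGenFactors

end
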